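import Summits.CriticalPhenomena.PercolationContinuityZ3.Theorems.PercNearOneGluingNoHeavyQuantLightResidDEC
import Summits.CriticalPhenomena.PercolationContinuityZ3.Theorems.PercNearOneGluingNoHeavyQuantHalfTop
import Summits.CriticalPhenomena.PercolationContinuityZ3.Theorems.PercNearOneGluingNoHeavyQuantLowCeiling
import HarnessLib

/-!
# QUANT lane R8, T-DEC: THE CLOSED-FORM CRITERIA AT THE CAPPED FLOOR — `LightResidDECAt x a L` from the budget / low-ceiling / half-top criteria
# evaluated at `y = min (a·x) (1/2)` (the landing pads for light certificates; arm-1 gen 50, architect)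

builds on p205010 (kernel theorem, internal audit signed; external expert review pending)

Support file (`--supports stmt-CriticalPhenomena-4575`), QUANT lane seat prim-quant-arm-1 (gen 50, architect), rung R8 of
`run/shared/lean/prim/quant/LADDER.md`; memo `run/shared/lean/prim/quant/prim-quant-arm-1-g50/ARCH-G50.md` §2/§4.  Theorems only (no definitions),
standard axioms, no sorries.  The mass-level criteria of arm-1 g49 (`decAt_all_of_budget` ✓ p423876, `decAt_all_of_lowCeiling` ✓ p425518,
`decAt_all_of_halfTop` ✓ p430395) are floor-generic; their residual wrappers in the tree (`residDECAt_of_budget`, `residDEC_of_lowCeiling`,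
`residDEC_of_halfTop`) are stated at the NATURAL gated floor `a·x`.  This file states them at the CAPPED floor `y = min (a·x) (1/2)` of the light node
`LightResidDECAt x a L` (`…QuantLightResidDEC`), where — ARCH-G50 §2, exact census on ≈ 41 000 (forest, outer-gate) pairs incl. 1 332 random heavy
forests — they have NO known exception (1 419 exceptions at the natural floor, all at heavy gated floors `a·x > 1/2`).
* `capFloor_facts` (`0 < y ≤ a·x`, `y ≤ 1/2`, `y < 1`, `y·ftop L ≤ a·fmean L` for tree-OK lists);
* **`lightResidDECAt_of_budget`** (torque-safe ceiling `H` and the budget inequality at `y`), **`lightResidDECAt_of_lowCeiling`** (`y·(ftop − l) ≤ T − l`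
  for every charged positive low `l`), **`lightResidDECAt_of_halfTop`** (`2·y·ftop L ≤ a·fmean L·(1 + y)`), and the heavy-gate corollary
  **`lightResidDECAt_of_top_le_of_half_le`**: if `a·x ≥ 1/2` then `2·ftop L ≤ 3·a·fmean L` suffices (the capped floor is `1/2`);
* `lightResidDECAt_of_noLow` (no positive low atom: any floor).
No-low / regime / heavy-roots certificates at the natural floor transfer by `lightResidDECAt_of_residDECAt` (✓ `…QuantLightResidDEC`).

HONEST STATUS: certificate infrastructure; `LightResidDEC`, `ResidDEC`, `SiblingStep`, `FarTreeRow` OPEN; RATE class log\* / honest sentence of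
`run/shared/lean/prim/quant/README.md` unchanged.  [this work]; criteria: prim-quant-arm-1 g49; one-low / two-low partners: prim-quant-census-1 g24.
Nothing here is cited as a published result.  The gluing rows served [cite: KozmaNitzan2024, Conjecture 3 (p. 15)]; product measure
[cite: Grimmett1999, §1.3 p. 10].
-/

noncomputable section

open scoped BigOperators

namespace Summit.CriticalPhenomena.PercolationContinuityZ3.Theorems
namespace Quant
namespace LawDec

open Finset

/-! ### The capped floor -/

/-- facts of the capped floor `y = min (a·x) (1/2)` for a tree-OK list at floor `0 < x < 1` and `0 < a`: `0 < y`, `y ≤ a·x`, `y ≤ 1/2`,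
`y < 1`, and top-affordability `y·ftop L ≤ a·fmean L`. [this work] -/
theorem capFloor_facts {x a : ℝ} (hx0 : 0 < x) (hx1 : x < 1) (ha0 : 0 < a) (L : List Sib) (hL : ∀ s ∈ L, s.TreeOK x) :
    0 < min (a * x) (1 / 2) ∧ min (a * x) (1 / 2) ≤ a * x ∧ min (a * x) (1 / 2) ≤ 1 / 2 ∧ min (a * x) (1 / 2) < 1 ∧
      min (a * x) (1 / 2) * (ftop L : ℝ) ≤ a * fmean L := by
  refine ⟨lt_min (mul_pos ha0 hx0) (by norm_num), min_le_left _ _, min_le_right _ _,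
    lt_of_le_of_lt (min_le_right _ _) (by norm_num), ?_⟩
  calc min (a * x) (1 / 2) * (ftop L : ℝ) ≤ a * x * (ftop L : ℝ) :=
        mul_le_mul_of_nonneg_right (min_le_left _ _) (Nat.cast_nonneg _)
    _ = a * (x * (ftop L : ℝ)) := by ring
    _ ≤ a * fmean L := mul_le_mul_of_nonneg_left (ftop_mul_floor_le_fmean hx0 hx1 L hL) ha0.le

/-- the residual's law facts at the canonical weight for a list of at least two tree-OK siblings (nonnegative, vanishing above `ftop`, mass `1`,
mean `a·fmean L > 0`). [this work] -/
theorem resid_laws_of_two_le {x a : ℝ} (ha0 : 0 < a) (ha1 : a < 1) (L : List Sib) (hL : ∀ s ∈ L, s.TreeOK x)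
    (hk : 2 ≤ L.length) :
    (∀ h, 0 ≤ resid a (wco a L) L h) ∧ (∀ h, ftop L < h → resid a (wco a L) L h = 0) ∧
      (∑ h ∈ Finset.range (ftop L + 1), resid a (wco a L) L h = 1) ∧
      (∑ h ∈ Finset.range (ftop L + 1), (h : ℝ) * resid a (wco a L) L h = a * fmean L) ∧ 0 < a * fmean L := by
  have hL' : ∀ s ∈ L, s.LawOK := fun s hs => (hL s hs).lawOK
  have hne : L ≠ [] := by rintro rfl; simp at hk
  obtain ⟨s, t, L', rfl⟩ : ∃ s t L', L = s :: t :: L' := by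
    rcases L with _ | ⟨s, _ | ⟨t, L'⟩⟩
    · exact absurd rfl hne
    · simp at hk
    · exact ⟨s, t, L', rfl⟩
  have hw1 : wco a (s :: t :: L') < 1 := wco_lt_one ha1 s t L' hL'
  obtain ⟨r0, rM, r1, rmn⟩ := resid_laws ha0 ha1.le (s :: t :: L') hL' le_rfl hw1
  exact ⟨r0, rM, r1, rmn, mul_pos ha0 ((fmean_pos _ hL).2 hne)⟩

/-! ### The criteria at the capped floor -/

/-- **`LightResidDECAt` FROM THE BUDGET CRITERION AT THE CAPPED FLOOR.**  Tree-built siblings (at least two) at floor `0 < x < 1`, `0 < a < 1`,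
`y = min (a·x) (1/2)`, `T = a·fmean L`, `R = resid a (wco a L) L`: if `H` is torque-safe for every charged positive low atom (`y·(H − l) ≤ T − l`) and
`Σ_{1 ≤ l, 2l < T} R(l)(T − l) ≤ Σ_{T < h ≤ H} R(h)(h − T)`, then `R` is DEC at `y` at every layer below the top. [this work] -/
theorem lightResidDECAt_of_budget {x a : ℝ} (hx0 : 0 < x) (hx1 : x < 1) (ha0 : 0 < a) (ha1 : a < 1) (H : ℕ) (L : List Sib)
    (hL : ∀ s ∈ L, s.TreeOK x) (hk : 2 ≤ L.length)
    (hsafe : ∀ l : ℕ, 1 ≤ l → 2 * (l : ℝ) < a * fmean L → 0 < resid a (wco a L) L l →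
      min (a * x) (1 / 2) * ((H : ℝ) - l) ≤ a * fmean L - l)
    (hbud : ∑ l ∈ Finset.range (ftop L + 1),
        (if (1 ≤ l ∧ 2 * (l : ℝ) < a * fmean L) then resid a (wco a L) L l * (a * fmean L - l) else 0)
      ≤ ∑ h ∈ Finset.range (ftop L + 1),
        (if (a * fmean L < (h : ℝ) ∧ h ≤ H) then resid a (wco a L) L h * ((h : ℝ) - a * fmean L) else 0)) :
    LightResidDECAt x a L := by
  obtain ⟨hy0, _, _, hy1, hta⟩ := capFloor_facts hx0 hx1 ha0 L hL
  obtain ⟨r0, rM, r1, rmn, hT0⟩ := resid_laws_of_two_le ha0 ha1 L hL hk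
  exact decAt_all_of_budget (min (a * x) (1 / 2)) (ftop L) H (resid a (wco a L) L) (a * fmean L) hy0 hy1 r0 rM r1 rmn hT0 hta hsafe hbud

/-- **`LightResidDECAt` FROM THE LOW CEILING AT THE CAPPED FLOOR**: every charged positive low atom `l` of the residual satisfies
`y·(ftop L − l) ≤ a·fmean L − l` with `y = min (a·x) (1/2)`. [this work] -/
theorem lightResidDECAt_of_lowCeiling {x a : ℝ} (hx0 : 0 < x) (hx1 : x < 1) (ha0 : 0 < a) (ha1 : a < 1) (L : List Sib)
    (hL : ∀ s ∈ L, s.TreeOK x) (hk : 2 ≤ L.length)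
    (hceil : ∀ l : ℕ, 1 ≤ l → 2 * (l : ℝ) < a * fmean L → 0 < resid a (wco a L) L l →
      min (a * x) (1 / 2) * ((ftop L : ℝ) - l) ≤ a * fmean L - l) :
    LightResidDECAt x a L := by
  obtain ⟨hy0, _, _, hy1, hta⟩ := capFloor_facts hx0 hx1 ha0 L hL
  obtain ⟨r0, rM, r1, rmn, hT0⟩ := resid_laws_of_two_le ha0 ha1 L hL hk
  exact decAt_all_of_lowCeiling (min (a * x) (1 / 2)) (ftop L) (resid a (wco a L) L) (a * fmean L) hy0 hy1 r0 rM r1 rmn hT0 hta hceil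

/-- **`LightResidDECAt` FOR A LIGHT-HALF-TOP FOREST**: `2·y·ftop L ≤ a·fmean L·(1 + y)` with `y = min (a·x) (1/2)`. [this work] -/
theorem lightResidDECAt_of_halfTop {x a : ℝ} (hx0 : 0 < x) (hx1 : x < 1) (ha0 : 0 < a) (ha1 : a < 1) (L : List Sib)
    (hL : ∀ s ∈ L, s.TreeOK x) (hk : 2 ≤ L.length)
    (hhalf : 2 * min (a * x) (1 / 2) * (ftop L : ℝ) ≤ a * fmean L * (1 + min (a * x) (1 / 2))) :
    LightResidDECAt x a L := by
  obtain ⟨hy0, _, _, hy1, _⟩ := capFloor_facts hx0 hx1 ha0 L hL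
  obtain ⟨r0, rM, r1, rmn, hT0⟩ := resid_laws_of_two_le ha0 ha1 L hL hk
  exact decAt_all_of_halfTop (min (a * x) (1 / 2)) (ftop L) (resid a (wco a L) L) (a * fmean L) hy0 hy1 r0 rM r1 rmn hT0 hhalf

/-- **THE HEAVY-GATE COROLLARY**: when the natural gated floor is heavy (`1/2 ≤ a·x`) the capped floor is `1/2`, and `2·ftop L ≤ 3·(a·fmean L)`
alone gives `LightResidDECAt x a L` (the half-top condition at `y = 1/2`). [this work] -/
theorem lightResidDECAt_of_top_le_of_half_le {x a : ℝ} (hx0 : 0 < x) (hx1 : x < 1) (ha0 : 0 < a) (ha1 : a < 1) (L : List Sib)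
    (hL : ∀ s ∈ L, s.TreeOK x) (hk : 2 ≤ L.length) (hax : 1 / 2 ≤ a * x) (htop : 2 * (ftop L : ℝ) ≤ 3 * (a * fmean L)) :
    LightResidDECAt x a L := by
  refine lightResidDECAt_of_halfTop hx0 hx1 ha0 ha1 L hL hk ?_
  rw [min_eq_right hax]
  linarith

/-- **`LightResidDECAt` WHEN THE RESIDUAL CHARGES NO POSITIVE LOW ATOM** (`2l ≥ a·fmean L` for every charged `l ≥ 1`): the low-ceiling hypothesis is
vacuous (any floor). [this work] -/
theorem lightResidDECAt_of_noLow {x a : ℝ} (hx0 : 0 < x) (hx1 : x < 1) (ha0 : 0 < a) (ha1 : a < 1) (L : List Sib)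
    (hL : ∀ s ∈ L, s.TreeOK x) (hk : 2 ≤ L.length)
    (hno : ∀ l : ℕ, 1 ≤ l → 0 < resid a (wco a L) L l → a * fmean L ≤ 2 * (l : ℝ)) :
    LightResidDECAt x a L :=
  lightResidDECAt_of_lowCeiling hx0 hx1 ha0 ha1 L hL hk fun l hl hlow hpos => absurd (hno l hl hpos) (not_le.2 hlow)

/-- **THE LIGHT NODE ON THE NATURAL HALF-TOP FAMILY** (schema instance, transferred from ✓ `residDECOn_halfTop`): every list of `≥ 3` tree-OK
siblings with `2·x·ftop L ≤ fmean L` satisfies the light node at every outer gate. [this work] -/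
theorem lightResidDECOn_halfTop : LightResidDECOn (fun x L => SibFam₃ x L ∧ 2 * x * (ftop L : ℝ) ≤ fmean L) :=
  lightResidDECOn_of_residDECOn residDECOn_halfTop

end LawDec
end Quant
end Summit.CriticalPhenomena.PercolationContinuityZ3.Theorems
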